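import Mathlib
import Summits.HodgeConjecture.HodgeConjecture.Theses.HeckePrymWeil
import Literature.AlgebraicGeometry.HodgeTheory.WeilClasses

/-!
# Sketch — crux `SummitOffWeilSector` (stmt-HodgeConjecture-1264), round 1, ideator 2

The crux is the route's NOT-CLAIMED summit complement
`SummitOffWeilSector := WeilSectorP → HodgeConjecture`, where `WeilSectorP` (below, verbatim the
antecedent of the route decl) says: every rational `(n,n)`-class in the complexified Weil plane of
every `2n`-dimensional complex abelian variety carrying `φ` with `φ ≫ φ = -p`, `p ≡ 3 (4)` prime,
`p ≥ 7`, is algebraic.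

This file records, over existing declarations only:

* `summitOffWeilSector_iff` — the crux IS that implication (definitional);
* `summitOffWeilSector_of_hodgeConjecture`, `summitOffWeilSector_of_not_weilSectorP`,
  `summitOffWeilSector_iff_or` — the logical shape: the crux holds iff (the summit holds OR one
  ℚ(√-p)-Weil class is not algebraic); every concluding skeleton therefore proves the summit for all
  varieties outside the reach of the hypothesis;
* `conj_comp_conj` (proved) and `weilSectorP_conj` (proved) — the ORBIT SATURATION remark: the
  hypothesis is stable under conjugating `φ` by automorphisms, so it delivers the whole
  `Aut(A)`-orbit span of Weil planes (the positive content analysed in `IdeatorTwoNotes.md` §3);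
* `orbit_transport` (signature, sorry) — pull-back along an automorphism carries the Weil plane of
  `(A, φ)` onto the Weil plane of the conjugate structure (bookkeeping for §3).
-/

namespace Summit.HodgeConjecture.HodgeConjecture.Cruxes.SummitOffWeilSector.IdeatorTwo

open CategoryTheory
open Summit.HodgeConjecture.HodgeConjecture.Theses.HeckePrymWeil
open Literature.AlgebraicGeometry Literature.AlgebraicGeometry.Motives
  Literature.AlgebraicGeometry.HodgeTheory

/-- The hypothesis of the crux: the ℚ(√-p)-Hodge–Weil sector (verbatim antecedent of
`HeckePrymWeil.SummitOffWeilSector`). -/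
def WeilSectorP : Prop :=
  ∀ p : ℕ, p.Prime → p % 4 = 3 → 7 ≤ p → ∀ n : ℕ, 1 ≤ n → ∀ (A : Literature.AlgebraicGeometry.Motives.AbelianVariety ℂ) (φ : A ⟶ A), A.dim = (2 * n) → CategoryTheory.CategoryStruct.comp φ φ = -((p : ℤ) • CategoryTheory.CategoryStruct.id A) → ∀ c : Literature.AlgebraicGeometry.HodgeTheory.complexBetti A.X (2 * n), Literature.AlgebraicGeometry.HodgeTheory.IsRationalClass c → Literature.AlgebraicGeometry.HodgeTheory.IsOfHodgeType (2 * n) A.X (2 * n) n n c → c ∈ Module.End.eigenspace (Literature.AlgebraicGeometry.HodgeTheory.complexBetti.map (CategoryTheory.CategoryStruct.id A + φ).hom.hom.hom (2 * n)).hom ((1 + Complex.I * (Real.sqrt (p : ℝ) : ℂ)) ^ (2 * n)) ⊔ Module.End.eigenspace (Literature.AlgebraicGeometry.HodgeTheory.complexBetti.map (CategoryTheory.CategoryStruct.id A + φ).hom.hom.hom (2 * n)).hom ((1 - Complex.I * (Real.sqrt (p : ℝ) : ℂ)) ^ (2 * n)) → c ∈ Literature.AlgebraicGeometry.HodgeTheory.algebraicClasses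 A.X n

/-- The crux is literally `WeilSectorP → HodgeConjecture`. -/
theorem summitOffWeilSector_iff : SummitOffWeilSector ↔ (WeilSectorP → _root_.HodgeConjecture) :=
  Iff.rfl

/-- (i) The crux is a formal consequence of the summit (so it closes the moment any route closes
the summit, and conversely restricted to any class of varieties untouched by the hypothesis it IS
the summit there). -/
theorem summitOffWeilSector_of_hodgeConjecture (h : _root_.HodgeConjecture) : SummitOffWeilSector :=
  fun _ => h

/-- (ii) … and of the failure of its own hypothesis (one non-algebraic ℚ(√-p)-Weil class — Weil's
1977 candidate counterexamples — makes it vacuously true). -/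
theorem summitOffWeilSector_of_not_weilSectorP (h : ¬ WeilSectorP) : SummitOffWeilSector :=
  fun hW => (h hW).elim

/-- (iii) The dichotomy: `SummitOffWeilSector ↔ (¬ WeilSectorP ∨ HodgeConjecture)`. -/
theorem summitOffWeilSector_iff_or :
    SummitOffWeilSector ↔ (¬ WeilSectorP ∨ _root_.HodgeConjecture) := by
  constructor
  · intro h
    by_cases hW : WeilSectorP
    · exact Or.inr (h hW)
    · exact Or.inl hW
  · rintro (h | h) hW
    · exact (h hW).elim
    · exact h

/-! ### Orbit saturation: the hypothesis is `Aut(A)`-stable -/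

/-- Conjugating a square root of `-p` by an automorphism gives a square root of `-p`
(`Preadditive` bilinearity of composition on `AbelianVariety ℂ`). -/
theorem conj_comp_conj {A : AbelianVariety ℂ} (φ : A ⟶ A) (e : A ≅ A) (p : ℤ)
    (hφ : φ ≫ φ = -(p • 𝟙 A)) :
    (e.inv ≫ φ ≫ e.hom) ≫ (e.inv ≫ φ ≫ e.hom) = -(p • 𝟙 A) := by
  have h1 : (e.inv ≫ φ ≫ e.hom) ≫ (e.inv ≫ φ ≫ e.hom) = e.inv ≫ (φ ≫ φ) ≫ e.hom := by
    simp only [Category.assoc, e.hom_inv_id_assoc]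
  rw [h1, hφ, Preadditive.neg_comp, Preadditive.comp_neg, Preadditive.zsmul_comp,
    Preadditive.comp_zsmul, Category.id_comp, e.inv_hom_id]

/-- ORBIT SATURATION (bookkeeping, proved): the sector hypothesis applies verbatim to every
conjugate structure `(A, e⁻¹ φ e)`; hence it delivers the algebraicity of the whole span
`Σ_e e^*(Weil plane of (A, φ))` over automorphisms `e` of `A` (and of `A^m` for the structures
`φ ⊗ J`, `J ∈ M_m(ℤ)`, `J² = -1`·…), whose extent is computed by Howe duality in
`IdeatorTwoNotes.md` §3. -/
theorem weilSectorP_conj (hW : WeilSectorP) (p : ℕ) (hp : p.Prime) (hp4 : p % 4 = 3) (hp7 : 7 ≤ p)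
    (n : ℕ) (hn : 1 ≤ n) (A : AbelianVariety ℂ) (φ : A ⟶ A) (hA : A.dim = 2 * n)
    (hφ : φ ≫ φ = -((p : ℤ) • 𝟙 A)) (e : A ≅ A)
    (c : complexBetti A.X (2 * n)) (hc : IsRationalClass c)
    (hh : IsOfHodgeType (2 * n) A.X (2 * n) n n c)
    (hmem : c ∈ Module.End.eigenspace (complexBetti.map (𝟙 A + (e.inv ≫ φ ≫ e.hom)).hom.hom.hom (2 * n)).hom ((1 + Complex.I * (Real.sqrt (p : ℝ) : ℂ)) ^ (2 * n)) ⊔ Module.End.eigenspace (complexBetti.map (𝟙 A + (e.inv ≫ φ ≫ e.hom)).hom.hom.hom (2 * n)).hom ((1 - Complex.I * (Real.sqrt (p : ℝ) : ℂ)) ^ (2 * n))) :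
    c ∈ algebraicClasses A.X n :=
  hW p hp hp4 hp7 n hn A (e.inv ≫ φ ≫ e.hom) hA (conj_comp_conj φ e p hφ) c hc hh hmem

/-- ORBIT TRANSPORT (signature only; routine functoriality of pull-back, cf.
`HodgeTheory.map_mem_weilClassesOf` for endomorphisms commuting with `φ`): pull-back along the
automorphism `e` maps the Weil plane of `(A, φ)` (in the tree's `weilClassesOf` form, `d = p`) into
the Weil plane of the conjugate structure `(A, e.hom ≫ φ ≫ e.inv)`. Together with
`weilSectorP_conj` this is the typed form of "the hypothesis gives the `Aut`-orbit span". -/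
theorem orbit_transport {A : AbelianVariety ℂ} (φ : A ⟶ A) (e : A ≅ A) (n d : ℕ)
    (c : complexBetti A.X (2 * n)) (hc : c ∈ weilClassesOf A φ n d) :
    complexBetti.map e.hom.hom.hom.hom (2 * n) c ∈ weilClassesOf A (e.hom ≫ φ ≫ e.inv) n d := by
  sorry

end Summit.HodgeConjecture.HodgeConjecture.Cruxes.SummitOffWeilSector.IdeatorTwo
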